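import Summits.CriticalPhenomena.PercolationContinuityZ3.Theorems.SahiAEOpenBandChart

/-!
# Open bands in every dimension: two-sided bounds for the corrected density on small corner boxes

Support file of the Sahi cell (`prim-sahi`, typer seat, generation 25; `--supports stmt-CriticalPhenomena-4575`).
One definition with data (`ChartAt`, the chart data at a point, and its derived quantities), theorems otherwise;
no named facts, no sorries.

Sixth file of the structure theorem for densities with zeros in every dimension.  At every point `p` of the open
band `U` we assemble (`exists_chartAt`) a family base point `c_m` with `p` in its arm box, a rational patch box
`K_j ⊇ [c_m, p]`, and in every direction `i` the one-dimensional charts of `SahiAEOpenBandChart.lean`.  On the corner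
boxes `∏ (pᵢ − rₙ, pᵢ]`, `n ≥ n₀`, the corrected density `q = 𝟙_U exp(φ − lineSum)` then satisfies almost everywhere

  `lb ≤ q(x) ≤ ub n`,   `ub n = F_m(p) · exp(Σᵢ (D'ᵢ(pᵢ) − Dᵢ(pᵢ − rₙ)) − C)`

(`ChartAt.ae_bounds`), where `F_m` is the monotone envelope factor of the chart and `Dᵢ, D'ᵢ` are the honest monotone
versions of the two line gaps; `lb > 0` and `ub n < ∞`.  Consequently the lower-corner envelope of `q` is positive
and finite at EVERY point of `U` (`cornerEnvelope_corrDensity_ne_zero/_ne_top`), and at almost every point of `U`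
it is `≤ q` (`ae_cornerEnvelope_corrDensity_le`: at good heights `ub n → q(p)`), hence `= q` almost everywhere on
`U` (`ae_le_cornerEnvelope`).  No sorries, no new axioms.
-/

noncomputable section

namespace Summit.CriticalPhenomena.PercolationContinuityZ3.Theorems.SahiAEFourFunctions

open MeasureTheory Set Filter Topology Function Metric
open scoped ENNReal NNReal

variable {ι : Type*} [Fintype ι] [DecidableEq ι]

/-! ### Chart data at a point -/

/-- **Chart data at a point `p` of the open band**: a family base point `c_m` with `p ∈ armBox U c_m`, a rational
patch box `K_j ⊇ [c_m, p]`, in every direction `i` the left-selected index `κᵢ`, an upper line `c_{lᵢ}` and a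
rational window `wᵢ` around `pᵢ` (valid charts for both line gaps), and an index `n₀` from which on the corner boxes
at `p` lie above `c_m` and inside the inner windows. [this work] -/
structure ChartAt (U : Set (ι → ℝ)) (φ : (ι → ℝ) → ℝ) (c : ℕ → ι → ℝ) (p : ι → ℝ) where
  /-- index of the base point -/
  m : ℕ
  /-- the rational patch box -/
  j : (ι → ℚ) × (ι → ℚ)
  /-- left-selected indices -/
  κ : ι → ℕ
  /-- upper lines -/
  l : ι → ℕ
  /-- rational windows -/
  w : ι → ℚ × ℚ × ℚ × ℚ
  /-- first good corner index -/
  n₀ : ℕ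
  isPatch : ∃ g, IsPatchFn φ j g
  mem_armBox : p ∈ armBox U (c m)
  box : Icc (c m) p ⊆ Icc (ratLo j) (ratHi j)
  valid_m : ∀ i, GapValid U c i (l i) m (w i)
  valid_κ : ∀ i, GapValid U c i (l i) (κ i) (w i)
  lo_lt : ∀ i, winLo' (w i) < p i
  lt_hi : ∀ i, p i < winHi' (w i)
  sel : ∀ i, ∀ t ∈ Ioo (winLo' (w i)) (p i), lineValue U φ c i t = φ (update (c (κ i)) i t)
  sel_at : ∀ i, p i ∉ endpts U c i → lineValue U φ c i (p i) = φ (update (c (κ i)) i (p i))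
  rad_base : ∀ i, cornerRadius n₀ < p i - c m i
  rad_win : ∀ i, cornerRadius n₀ < p i - winLo' (w i)

namespace ChartAt

variable {U : Set (ι → ℝ)} {φ : (ι → ℝ) → ℝ} {c : ℕ → ι → ℝ} {p : ι → ℝ}

/-- The envelope factor of the chart. [this work] -/
def F (Λ : ChartAt U φ c p) : (ι → ℝ) → ℝ≥0∞ := cornerEnvelope (orthantDensity (patch φ Λ.j) (c Λ.m))

/-- The honest version of the gap `φ(c_l;·) − φ(c_m;·)`. [this work] -/
def D (Λ : ChartAt U φ c p) (i : ι) : ℝ → ℝ := honestGap φ c i (Λ.l i) Λ.m (Λ.w i)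

/-- The honest version of the gap `φ(c_l;·) − φ(c_κ;·)`. [this work] -/
def D' (Λ : ChartAt U φ c p) (i : ι) : ℝ → ℝ := honestGap φ c i (Λ.l i) (Λ.κ i) (Λ.w i)

/-- The constant `(|ι| − 1) φ(c_m)`. [this work] -/
def C (Λ : ChartAt U φ c p) : ℝ := ((Fintype.card ι : ℝ) - 1) * φ (c Λ.m)

/-- The upper bound on the `n`-th corner box. [this work] -/
def ub (Λ : ChartAt U φ c p) (n : ℕ) : ℝ≥0∞ :=
  Λ.F p * ENNReal.ofReal (Real.exp (∑ i, (Λ.D' i (p i) - Λ.D i (p i - cornerRadius n)) - Λ.C))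

/-- The lower bound on the corner boxes from `n₀` on. [this work] -/
def lb (Λ : ChartAt U φ c p) : ℝ≥0∞ :=
  Λ.F (fun i => p i - cornerRadius Λ.n₀) *
    ENNReal.ofReal (Real.exp (∑ i, (Λ.D' i (p i - cornerRadius Λ.n₀) - Λ.D i (p i)) - Λ.C))

/-- The envelope factor is monotone, finite, and positive above `c_m`. [this work] -/
theorem F_spec (hφ : Measurable φ) (hF : BandFamily U φ c) (Λ : ChartAt U φ c p) :
    Monotone Λ.F ∧ (∀ x, Λ.F x ≠ ∞) ∧ ∀ x, (∀ i, c Λ.m i < x i) → Λ.F x ≠ 0 :=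
  chartEnvelope_spec hφ hF Λ.m Λ.j

/-- The upper bounds are finite. [this work] -/
theorem ub_ne_top (hφ : Measurable φ) (hF : BandFamily U φ c) (Λ : ChartAt U φ c p) (n : ℕ) : Λ.ub n ≠ ∞ :=
  ENNReal.mul_ne_top ((Λ.F_spec hφ hF).2.1 p) ENNReal.ofReal_ne_top

/-- The lower bound is positive. [this work] -/
theorem lb_ne_zero (hφ : Measurable φ) (hF : BandFamily U φ c) (Λ : ChartAt U φ c p) : Λ.lb ≠ 0 :=
  mul_ne_zero ((Λ.F_spec hφ hF).2.2 _ fun i => by linarith [Λ.rad_base i])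
    (ENNReal.ofReal_pos.2 (Real.exp_pos _)).ne'

/-- The honest gaps are monotone. [folklore] -/
theorem monotone_D (Λ : ChartAt U φ c p) (i : ι) : Monotone (Λ.D i) := monotone_honestGap φ c i _ _ _

/-- The honest gaps are monotone. [folklore] -/
theorem monotone_D' (Λ : ChartAt U φ c p) (i : ι) : Monotone (Λ.D' i) := monotone_honestGap φ c i _ _ _

end ChartAt

omit [DecidableEq ι] in
/-- Almost every point has all its coordinates different from those of a given point. [folklore] -/
theorem ae_apply_ne (p : ι → ℝ) : ∀ᵐ x ∂(volume : Measure (ι → ℝ)), ∀ i, x i ≠ p i := by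
  refine ae_all_iff.2 fun i => ?_
  have h : (volume : Measure ℝ) {p i} = 0 := Real.volume_singleton
  have h' := (SahiAESeparableTilt.quasiMeasurePreserving_eval (ι := ι) i).preimage_null h
  rw [ae_iff]
  refine measure_mono_null (fun x hx => ?_) h'
  simp only [Set.mem_setOf_eq, not_not] at hx
  exact hx

/-- **Chart data exist at every point of the open band.** [this work] -/
theorem exists_chartAt {U : Set (ι → ℝ)} (hU : IsOpenBand U) {φ : (ι → ℝ) → ℝ} (hφ : Measurable φ)
    (hsmU : ∀ᵐ q ∂(volume : Measure (ι → ℝ)).prod volume,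
      q.1 ∈ U → q.2 ∈ U → φ q.1 + φ q.2 ≤ φ (q.1 ⊓ q.2) + φ (q.1 ⊔ q.2))
    {c : ℕ → ι → ℝ} (hF : BandFamily U φ c) {p : ι → ℝ} (hp : p ∈ U) : Nonempty (ChartAt U φ c p) := by
  classical
  obtain ⟨m, hpm⟩ := hU.exists_mem_armBox hF.dense hp
  obtain ⟨j, hj, hbox⟩ := exists_patch_of_mem_armBox hU hφ hsmU hF hpm
  choose κ l w hvm hvκ hlo hhi hsel hselat using fun i => exists_coordChart hU hF hpm i
  have h1 : ∀ i, ∀ᶠ n in atTop, cornerRadius n < p i - c m i := fun i =>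
    eventually_cornerRadius_lt (by linarith [hpm.1 i])
  have h2 : ∀ i, ∀ᶠ n in atTop, cornerRadius n < p i - winLo' (w i) := fun i =>
    eventually_cornerRadius_lt (by linarith [hlo i])
  obtain ⟨n₀, hn₀⟩ := ((eventually_all.2 h1).and (eventually_all.2 h2)).exists
  exact ⟨⟨m, j, κ, l, w, n₀, hj, hpm, hbox, hvm, hvκ, hlo, hhi, hsel, hselat, hn₀.1, hn₀.2⟩⟩

omit [Fintype ι] in
/-- The difference of the two line gaps is the gap between the base line and the selected line. [folklore] -/
theorem lineGap_sub_lineGap (φ : (ι → ℝ) → ℝ) (c : ℕ → ι → ℝ) (i : ι) (l m κ : ℕ) (t : ℝ) :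
    lineGap φ c i l κ t - lineGap φ c i l m t = φ (update (c m) i t) - φ (update (c κ) i t) := by
  simp only [lineGap]; ring

/-- **Two-sided bounds for the corrected density on the corner boxes of a chart**, almost everywhere on the `n`-th
corner box at `p` for `n ≥ n₀`. [this work] -/
theorem ChartAt.ae_bounds {U : Set (ι → ℝ)} (hU : IsOpenBand U) {φ : (ι → ℝ) → ℝ} (hφ : Measurable φ)
    {c : ℕ → ι → ℝ} (hF : BandFamily U φ c) {p : ι → ℝ} (Λ : ChartAt U φ c p) {n : ℕ} (hn : Λ.n₀ ≤ n) :
    ∀ᵐ x ∂(volume : Measure (ι → ℝ)).restrict (Set.pi univ fun i => Ioc (p i - cornerRadius n) (p i)),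
      Λ.lb ≤ corrDensity U φ c x ∧ corrDensity U φ c x ≤ Λ.ub n := by
  have hrn : cornerRadius n ≤ cornerRadius Λ.n₀ := cornerRadius_antitone hn
  obtain ⟨hFmono, hFT, hF0⟩ := Λ.F_spec hφ hF
  rw [ae_restrict_iff' (measurableSet_lowerCorner p _)]
  filter_upwards [ae_corrDensity_chart hφ hF Λ.m Λ.isPatch, ae_good_heights hF, ae_apply_ne p]
    with x hchart hgood hne hx
  have hxi : ∀ i, p i - cornerRadius n < x i ∧ x i ≤ p i := fun i => Set.mem_univ_pi.1 hx i
  have hxlt : ∀ i, x i < p i := fun i => lt_of_le_of_ne (hxi i).2 (hne i)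
  have hcx : ∀ i, c Λ.m i < x i := fun i => by linarith [(hxi i).1, Λ.rad_base i]
  have hxp : x ≤ p := fun i => (hxi i).2
  have hxU : x ∈ U := hU.Icc_subset_of_mem_armBox (hF.mem Λ.m) Λ.mem_armBox ⟨fun i => (hcx i).le, hxp⟩
  have hK : Icc (c Λ.m) x ⊆ Icc (ratLo Λ.j) (ratHi Λ.j) := fun z hz => Λ.box ⟨hz.1, hz.2.trans hxp⟩
  have hwin : ∀ i, x i ∈ Ioo (winLo' (Λ.w i)) (p i) := fun i =>
    ⟨by linarith [(hxi i).1, Λ.rad_win i], hxlt i⟩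
  have hwin' : ∀ i, x i ∈ Icc (winLo' (Λ.w i)) (winHi' (Λ.w i)) := fun i =>
    ⟨(hwin i).1.le, (hxlt i).le.trans (Λ.lt_hi i).le⟩
  -- the one-dimensional factors
  have hterm : ∀ i, φ (update (c Λ.m) i (x i)) - lineValue U φ c i (x i) = Λ.D' i (x i) - Λ.D i (x i) := by
    intro i
    rw [Λ.sel i (x i) (hwin i), ChartAt.D', ChartAt.D, (hgood i (Λ.l i) (Λ.κ i) (Λ.w i) (Λ.valid_κ i) (hwin' i)).1,
      (hgood i (Λ.l i) Λ.m (Λ.w i) (Λ.valid_m i) (hwin' i)).1, lineGap_sub_lineGap]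
  have hup : ∀ i, Λ.D' i (x i) - Λ.D i (x i) ≤ Λ.D' i (p i) - Λ.D i (p i - cornerRadius n) := fun i =>
    sub_le_sub (Λ.monotone_D' i (hxi i).2) (Λ.monotone_D i (hxi i).1.le)
  have hlow : ∀ i, Λ.D' i (p i - cornerRadius Λ.n₀) - Λ.D i (p i) ≤ Λ.D' i (x i) - Λ.D i (x i) := fun i =>
    sub_le_sub (Λ.monotone_D' i (by linarith [(hxi i).1])) (Λ.monotone_D i (hxi i).2)
  rw [hchart hcx hK hxU]
  simp only [hterm]
  constructor
  · refine mul_le_mul' (hFmono fun i => by linarith [(hxi i).1]) (ENNReal.ofReal_le_ofReal (Real.exp_le_exp.2 ?_))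
    exact sub_le_sub_right (Finset.sum_le_sum fun i _ => hlow i) _
  · refine mul_le_mul' (hFmono hxp) (ENNReal.ofReal_le_ofReal (Real.exp_le_exp.2 ?_))
    exact sub_le_sub_right (Finset.sum_le_sum fun i _ => hup i) _

/-- **The envelope of the corrected density is finite at every point of `U`.** [this work] -/
theorem cornerEnvelope_corrDensity_ne_top {U : Set (ι → ℝ)} (hU : IsOpenBand U) {φ : (ι → ℝ) → ℝ}
    (hφ : Measurable φ)
    (hsmU : ∀ᵐ q ∂(volume : Measure (ι → ℝ)).prod volume,
      q.1 ∈ U → q.2 ∈ U → φ q.1 + φ q.2 ≤ φ (q.1 ⊓ q.2) + φ (q.1 ⊔ q.2))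
    {c : ℕ → ι → ℝ} (hF : BandFamily U φ c) {p : ι → ℝ} (hp : p ∈ U) :
    cornerEnvelope (corrDensity U φ c) p ≠ ∞ := by
  obtain ⟨Λ⟩ := exists_chartAt hU hφ hsmU hF hp
  have h := Λ.ae_bounds hU hφ hF le_rfl
  exact ne_top_of_le_ne_top (Λ.ub_ne_top hφ hF Λ.n₀)
    (cornerEnvelope_le_of_ae_restrict_le (h.mono fun x hx => hx.2))

/-- **The envelope of the corrected density is positive at every point of `U`.** [this work] -/
theorem cornerEnvelope_corrDensity_ne_zero {U : Set (ι → ℝ)} (hU : IsOpenBand U) {φ : (ι → ℝ) → ℝ}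
    (hφ : Measurable φ)
    (hsmU : ∀ᵐ q ∂(volume : Measure (ι → ℝ)).prod volume,
      q.1 ∈ U → q.2 ∈ U → φ q.1 + φ q.2 ≤ φ (q.1 ⊓ q.2) + φ (q.1 ⊔ q.2))
    {c : ℕ → ι → ℝ} (hF : BandFamily U φ c) {p : ι → ℝ} (hp : p ∈ U) :
    cornerEnvelope (corrDensity U φ c) p ≠ 0 := by
  obtain ⟨Λ⟩ := exists_chartAt hU hφ hsmU hF hp
  have h := Λ.ae_bounds hU hφ hF le_rfl
  have hle : Λ.lb ≤ cornerEnvelope (corrDensity U φ c) p :=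
    le_cornerEnvelope_of_ae_restrict_le (h.mono fun x hx => hx.1)
  exact fun h0 => Λ.lb_ne_zero hφ hF (le_zero_iff.1 (h0 ▸ hle))

/-- Almost every point has no coordinate among the end-heights. [folklore] -/
theorem ae_not_mem_endpts (U : Set (ι → ℝ)) (c : ℕ → ι → ℝ) :
    ∀ᵐ p ∂(volume : Measure (ι → ℝ)), ∀ i, p i ∉ endpts U c i := by
  refine ae_all_iff.2 fun i => ?_
  have h := (SahiAESeparableTilt.quasiMeasurePreserving_eval (ι := ι) i).preimage_null
    ((countable_endpts U c i).measure_zero (volume : Measure ℝ))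
  rw [ae_iff]
  refine measure_mono_null (fun x hx => ?_) h
  simp only [Set.mem_setOf_eq, not_not] at hx
  exact hx

/-- **The envelope of the corrected density is at most the density at almost every point of `U`** (at good points
the upper bounds `ub n` tend to the density). [this work] -/
theorem ae_cornerEnvelope_corrDensity_le {U : Set (ι → ℝ)} (hU : IsOpenBand U) {φ : (ι → ℝ) → ℝ}
    (hφ : Measurable φ)
    (hsmU : ∀ᵐ q ∂(volume : Measure (ι → ℝ)).prod volume,
      q.1 ∈ U → q.2 ∈ U → φ q.1 + φ q.2 ≤ φ (q.1 ⊓ q.2) + φ (q.1 ⊔ q.2))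
    {c : ℕ → ι → ℝ} (hF : BandFamily U φ c) :
    ∀ᵐ p ∂(volume : Measure (ι → ℝ)), p ∈ U → cornerEnvelope (corrDensity U φ c) p ≤ corrDensity U φ c p := by
  have hcharts : ∀ᵐ p ∂(volume : Measure (ι → ℝ)), ∀ (m : ℕ) (j : (ι → ℚ) × (ι → ℚ)),
      (∃ g, IsPatchFn φ j g) → (∀ i, c m i < p i) → Icc (c m) p ⊆ Icc (ratLo j) (ratHi j) → p ∈ U →
        corrDensity U φ c p = cornerEnvelope (orthantDensity (patch φ j) (c m)) p *
          ENNReal.ofReal (Real.exp (∑ i, (φ (update (c m) i (p i)) - lineValue U φ c i (p i)) -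
            ((Fintype.card ι : ℝ) - 1) * φ (c m))) := by
    refine ae_all_iff.2 fun m => ae_all_iff.2 fun j => ?_
    by_cases hj : ∃ g, IsPatchFn φ j g
    · filter_upwards [ae_corrDensity_chart hφ hF m hj] with p hp _ using hp
    · exact Eventually.of_forall fun p hj' => absurd hj' hj
  filter_upwards [hcharts, ae_good_heights hF, ae_not_mem_endpts U c] with p hchart hgood hend hpU
  obtain ⟨Λ⟩ := exists_chartAt hU hφ hsmU hF hpU
  obtain ⟨hFmono, hFT, hF0⟩ := Λ.F_spec hφ hF
  -- the density at `p` in chart form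
  have hwin' : ∀ i, p i ∈ Icc (winLo' (Λ.w i)) (winHi' (Λ.w i)) := fun i => ⟨(Λ.lo_lt i).le, (Λ.lt_hi i).le⟩
  have hsumeq : ∑ i, (φ (update (c Λ.m) i (p i)) - lineValue U φ c i (p i)) =
      ∑ i, (Λ.D' i (p i) - Λ.D i (p i)) := by
    refine Finset.sum_congr rfl fun i _ => ?_
    rw [Λ.sel_at i (hend i), ChartAt.D', ChartAt.D,
      (hgood i (Λ.l i) (Λ.κ i) (Λ.w i) (Λ.valid_κ i) (hwin' i)).1,
      (hgood i (Λ.l i) Λ.m (Λ.w i) (Λ.valid_m i) (hwin' i)).1, lineGap_sub_lineGap]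
  have hqp : corrDensity U φ c p =
      Λ.F p * ENNReal.ofReal (Real.exp (∑ i, (Λ.D' i (p i) - Λ.D i (p i)) - Λ.C)) := by
    rw [hchart Λ.m Λ.j Λ.isPatch Λ.mem_armBox.1 Λ.box hpU, hsumeq]
    rfl
  -- the upper bounds converge to the density at `p`
  have hsum : Tendsto (fun n => ∑ i, (Λ.D' i (p i) - Λ.D i (p i - cornerRadius n))) atTop
      (𝓝 (∑ i, (Λ.D' i (p i) - Λ.D i (p i)))) := by
    refine tendsto_finsetSum _ fun i _ => ?_
    have hc : ContinuousAt (Λ.D i) (p i) := (hgood i (Λ.l i) Λ.m (Λ.w i) (Λ.valid_m i) (hwin' i)).2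
    have hr : Tendsto (fun n => p i - cornerRadius n) atTop (𝓝 (p i)) := by
      simpa using tendsto_const_nhds.sub (tendsto_cornerRadius_zero)
    exact tendsto_const_nhds.sub (hc.tendsto.comp hr)
  have hexp : Tendsto (fun n => ENNReal.ofReal (Real.exp (∑ i, (Λ.D' i (p i) - Λ.D i (p i - cornerRadius n)) - Λ.C)))
      atTop (𝓝 (ENNReal.ofReal (Real.exp (∑ i, (Λ.D' i (p i) - Λ.D i (p i)) - Λ.C)))) :=
    (ENNReal.continuous_ofReal.tendsto _).comp ((Real.continuous_exp.tendsto _).comp (hsum.sub_const _))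
  have htend : Tendsto Λ.ub atTop (𝓝 (corrDensity U φ c p)) := by
    rw [hqp]
    exact ENNReal.Tendsto.const_mul hexp (Or.inr (hFT p))
  refine ge_of_tendsto htend ((eventually_ge_atTop Λ.n₀).mono fun n hn => ?_)
  exact cornerEnvelope_le_of_ae_restrict_le ((Λ.ae_bounds hU hφ hF hn).mono fun x hx => hx.2)

/-- **The envelope of the corrected density is a version of it on `U`.** [this work] -/
theorem ae_cornerEnvelope_corrDensity_eq {U : Set (ι → ℝ)} (hU : IsOpenBand U) {φ : (ι → ℝ) → ℝ}
    (hφ : Measurable φ)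
    (hsmU : ∀ᵐ q ∂(volume : Measure (ι → ℝ)).prod volume,
      q.1 ∈ U → q.2 ∈ U → φ q.1 + φ q.2 ≤ φ (q.1 ⊓ q.2) + φ (q.1 ⊔ q.2))
    {c : ℕ → ι → ℝ} (hF : BandFamily U φ c) :
    ∀ᵐ p ∂(volume : Measure (ι → ℝ)), p ∈ U → cornerEnvelope (corrDensity U φ c) p = corrDensity U φ c p := by
  filter_upwards [ae_cornerEnvelope_corrDensity_le hU hφ hsmU hF,
    ae_le_cornerEnvelope (measurable_corrDensity hU.isOpen hφ c)] with p h1 h2 hp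
  exact le_antisymm (h1 hp) h2

end Summit.CriticalPhenomena.PercolationContinuityZ3.Theorems.SahiAEFourFunctions
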